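/-
Copyright (c) 2026 the pub-hodgecm-mathlib formalisation cell (harness21).  Prover seat hodgecm-mathlib-K2E1-p13 (g3), Track B ∕ K2-LIT, h413 = `stmt-HodgeConjecture-24833`,
line `K2_E1_TraceFormulaBeta`, route of record `HCCMUnconditional`; dealer K2E1-plan (g7) (266)∕(267) AMENDMENT #3 «GENERAL (U,τ) LADDER» G7: `hconj` at a `c_G`-STABLE LEVEL
`K′` (e.g. `K_∞·K_f(𝔫)`, `𝔫̄ = 𝔫`), `dim V > 1` allowed — ENTRYWISE in `c_G`-real bases, hypothesis-first on the ONE level letter `c_G(K′) ⊆ K′` and on the realness of the bases on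
double-coset representatives; the `K_max`∕rank-one case is ★ p860445.
-/
import Summits.HodgeConjecture.HodgeConjecture.Theorems.K2E1ChiSectionGaloisTwistLevelU2        -- ★ p860832 (this seat): (H3) at a general level; brings ★ p860352 (S1)–(S3), ★ p860213 toolkit, ★ `K2E1ChiSectionSpaceU2Defs`
import Summits.HodgeConjecture.HodgeConjecture.Theorems.K2E1ChiScatteringConjSymmetryM1CMTwo       -- ★ p860445 (this lineage, g2): `exists_galTwist_cm`; brings ★ TubeU2 (`integral_flatSectionU_comp_galTwist_two`), ★ p860146 (`conj_godementCoeffFun`, `apply_conj_eq_conj_apply_of_tube_of_poleSet`)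
import Literature.NumberTheory.Automorphic.UnitaryGroupIwasawaAdelic                                   -- ★ `exists_mem_borelAdelic_mul_mem_standardMaximalCompactGL_cm`
import HarnessLib

/-!
# K2·E1 — `K2E1ChiScatteringConjSymmetryLevelCMTwo`: THE REFLECTION SYMMETRY `qc_{ij}(conj z) = conj qc_{ij}(z)` OF THE SCATTERING MATRIX OF A SELF-DUAL UNITARY `χ` OF `U(1,1)_{L∕L⁺}` AT A
# `c_G`-STABLE LEVEL `K′` (AMENDMENT #3 G7) — entrywise in `c_G`-real bases, hypothesis-first on the level letter `c_G(K′) ⊆ K′` and the realness of the bases on representatives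

Track B ∕ K2-LIT, crux h413 = `stmt-HodgeConjecture-24833`; cell `hodgecm-mathlib`, squad K2, ENGINE E1, AMENDMENT #3 G7 (`hconj ⇒ hadj` at `𝔫̄ = 𝔫` levels; consumers: G6 `hreal ∧ hs` general
via ★ p860605's per-coordinate `hconj` letter, G8 `hadj`).  THEOREMS ONLY (no `def`, no `instance`, no notation, no named-fact hypothesis, no `sorry`; default heartbeats); lane
`--kind proof --supports stmt-HodgeConjecture-24833 --as helper` (count-neutral).  Closes no socket.

THE MATHEMATICS ([MoeglinWaldspurger1995, II.1.6–II.1.7, IV.1.10]; [Langlands1976, §7]; [GelbartRogawski1991, §3.1]).  Let `b_i ∈ V(χ, K′, ω)` and a linearly independent family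
`b′_j ∈ V(χʷ, K′, ω)` be `c_G`-REAL: `conj b(g) = b(c_G g)` (at a `c_G`-stable level this is (H3) ★ `conj_apply_eq_apply_galTwist_of_selfDual_of_reps` from realness on representatives).  On the
tube the scattering coordinates are defined by `Σ_j q_{ij}(z)·b′_j = r·φ̃^{b_i}_z·H^{z−1}` (`r` real; ★ X2_χ ∕ (α)'s `hqφ` clause per basis vector).  Conjugating pointwise: `conj(r·φ̃^{b_i}_z(g)·H(g)^{z−1})
= r·φ̃^{conj∘b_i}_{conj z}(g)·H(g)^{conj z−1}` (★ `conj_godementCoeffFun`) `= r·φ̃^{b_i}_{conj z}(c_G g)·H(c_G g)^{conj z−1}` (`conj∘b_i = b_i∘c_G`, the `c_G`-equivariance of the intertwining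
integral ★ `integral_flatSectionU_comp_galTwist_two`, `H∘c_G = H` ★ `borelHeight_galTwist`), i.e. `Σ_j conj q_{ij}(z)·b′_j(c_G g) = Σ_j q_{ij}(conj z)·b′_j(c_G g)`; as `c_G` is an involution
(★ `galTwist_galTwist`) and the `b′_j` are linearly independent, **`q_{ij}(conj z) = conj q_{ij}(z)` on the tube** (§1) — NO permutation in `c_G`-real bases.  For the continued `qc_{ij}`
(analytic off ONE closed co-discrete `P ⊆ {Re ≤ 1}`, `= q_{ij}` on the tube) the identity persists off `P ∪ conj P` (★ `apply_conj_eq_conj_apply_of_tube_of_poleSet`, §2).  §3 is the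
`U(1,1)_{L∕L⁺}` print at a level `K′` with the representatives `q.out`, `q ∈ K_max ⧸ (K′ ∩ K_max)` (★ `forall_exists_borel_mul_out_mul_of_iwasawa` ∘ ★ adelic Iwasawa), `c_G` from ★
`exists_galTwist_cm`: letters = the level letter **`hK : c_G(K′) ⊆ K′`** (for `K′ = K_∞·K_f(𝔫)`: `𝔫̄ = 𝔫`), the `K′`-type compatibility `hω`, and the realness of the two bases ON THE
REPRESENTATIVES (`hbreps`, `hb′reps` — finitely many conditions; existence of such bases is linear algebra of the conj-linear involution `φ ↦ conj∘φ∘c_G`, item (N2)(b)).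
* §1 **`matrix_tube_conj_of_real`** (generic `(F, E, c)`, `N = 2`).  * §2 **`matrix_conj_of_real_of_poleSet`**.  * §3 **`chi_scattering_matrix_conj_symm_level_cm_two`** (CM print).
HONEST LABEL: HC_CM is proved only modulo the 7 printed citations (2 remaining named inputs: hLiu418 = `stmt-HodgeConjecture-24832`, h413 = `stmt-HodgeConjecture-24833`) until rung 0
closes; this file asserts no named fact and closes no socket; count-neutral; hypothesis-first on `hK`, `hω`, the realness of the bases and the package clauses.

## References
* [MoeglinWaldspurger1995] C. Mœglin, J.-L. Waldspurger, *Spectral decomposition and Eisenstein series* (1995), II.1.6–II.1.7, IV.1.10.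
* [Langlands1976] R. P. Langlands, *On the Functional Equations Satisfied by Eisenstein Series*, LNM 544 (1976), §7.
* [GelbartRogawski1991] S. Gelbart, J. Rogawski, *L-functions and Fourier–Jacobi coefficients for the unitary group U(3)*, Invent. Math. 105 (1991), §3.1.
-/

set_option autoImplicit false
set_option linter.dupNamespace false  -- the mandated namespace repeats the summit's segment (`HodgeConjecture.HodgeConjecture`)

noncomputable section

open MeasureTheory Measure Set NumberField IsDedekindDomain Filter Topology
open scoped NNReal ComplexConjugate
open Literature.NumberTheory.Automorphic Literature.NumberTheory.Automorphic.UnitaryGroup AdelicGroupData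
open Literature.NumberTheory.GaloisRepresentations (HeckeCharacter)
open Summit.HodgeConjecture.HodgeConjecture.Cruxes.H413.K2E1BorelEisensteinU
open Summit.HodgeConjecture.HodgeConjecture.Cruxes.H413.K2E1CharacterEisensteinU2Defs
open Summit.HodgeConjecture.HodgeConjecture.Cruxes.H413.K2E1ChiSectionSpaceU2Defs
open Summit.HodgeConjecture.HodgeConjecture.Cruxes.H413.K2E1QuasiSplitGaloisTwistU2
open Summit.HodgeConjecture.HodgeConjecture.Cruxes.H413.K2E1QuasiSplitGaloisTwistUnipotentTwo (integral_flatSectionU_comp_galTwist_two)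
open Summit.HodgeConjecture.HodgeConjecture.Cruxes.H413.K2E1ChiScatteringConjSymmetryCMTwo (conj_godementCoeffFun apply_conj_eq_conj_apply_of_tube_of_poleSet)
open Summit.HodgeConjecture.HodgeConjecture.Cruxes.H413.K2E1ChiSectionGaloisTwistLevelU2 (conj_apply_eq_apply_galTwist_of_selfDual_of_reps)
open Summit.HodgeConjecture.HodgeConjecture.Cruxes.H413.K2E1ChiScatteringConjSymmetryM1CMTwo (exists_galTwist_cm)

namespace Summit.HodgeConjecture.HodgeConjecture.Cruxes.H413.K2E1ChiScatteringConjSymmetryLevelCMTwo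

/-! ## §1 The tube identity for matrix entries in `c_G`-real bases (generic `(F, E, c)`, `N = 2`) -/

section Generic

variable {F E : Type} [Field F] [NumberField F] [Field E] [NumberField E] [Algebra F E] {c : E ≃ₐ[F] E}
variable [MeasurableSpace (quasiSplit F E c 2).Adelic] [BorelSpace (quasiSplit F E c 2).Adelic]

/-- **`q_{ij}(conj z) = conj q_{ij}(z)` ON THE TUBE IN `c_G`-REAL BASES** (module docstring, §1): `c² = 1`, the Galois twist `(c_G, hcG)`, an inversion-invariant measure `ν` on `N(𝔸)`, a real
scalar `r`; `c_G`-real functions `b_i` and a LINEARLY INDEPENDENT `c_G`-real family `b′_j`; coordinates `q_{ij}` with `Σ_j q_{ij}(z)•b′_j = r•(φ̃^{b_i}_z·H^{z−1})` for `1 < Re z`.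
[cite: MoeglinWaldspurger1995, II.1.6–II.1.7, IV.1.10] [cite: Langlands1976, §7] -/
theorem matrix_tube_conj_of_real (hc : c * c = 1) {cG : (quasiSplit F E c 2).Adelic →* (quasiSplit F E c 2).Adelic}
    (hcG : ∀ g, adelicVal F E c 2 _ (cG g) = Matrix.GeneralLinearGroup.map (conjAdele F E c) (adelicVal F E c 2 _ g))
    (ν : Measure ↥(adelicUnipotent F E c 2)) [ν.IsInvInvariant] (r : ℝ)
    {ι ι' : Type*} [Fintype ι'] {b : ι → (quasiSplit F E c 2).Adelic → ℂ} {b' : ι' → (quasiSplit F E c 2).Adelic → ℂ}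
    (hb : ∀ i g, conj (b i g) = b i (cG g)) (hb' : ∀ j g, conj (b' j g) = b' j (cG g)) (hli : LinearIndependent ℂ b')
    {q : ι → ι' → ℂ → ℂ}
    (hq : ∀ i (z : ℂ), 1 < z.re → (∑ j, q i j z • b' j) = ((r : ℝ) : ℂ) • (fun g : (quasiSplit F E c 2).Adelic => (∫ v : ↥(adelicUnipotent F E c 2), flatSectionU (b i) z (((quasiSplit F E c 2).toAdelic (weylLongU (c : E →+* E) (rfl : (StdForm.antidiagonal 2).over E = (StdForm.antidiagonal 2).over E))) * ((v : (quasiSplit F E c 2).Adelic) * g)) ∂ν) * (((borelHeight g : ℝ) : ℂ) ^ (z - 1)))) :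
    ∀ i j (z : ℂ), 1 < z.re → q i j (conj z) = conj (q i j z) := by
  classical
  intro i j z hz
  have hz' : 1 < (conj z).re := by rwa [Complex.conj_re]
  have hbi : (fun y => conj (b i y)) = fun y => b i (cG y) := funext (hb i)
  -- the conjugated identity at `z`, read at `c_G g`, is the identity at `conj z`
  have key : ∀ g, ∑ j', conj (q i j' z) * b' j' (cG g) = ∑ j', q i j' (conj z) * b' j' (cG g) := by
    intro g
    have hA := congrFun (hq i z hz) g
    have hB := congrFun (hq i (conj z) hz') (cG g)
    simp only [Finset.sum_apply, Pi.smul_apply, smul_eq_mul] at hA hB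
    rw [borelHeight_galTwist hcG g, ← integral_flatSectionU_comp_galTwist_two hc hcG ν (b i) (conj z) g, ← hbi] at hB
    have hC := conj_godementCoeffFun ν r (b i) z (fun (g : (quasiSplit F E c 2).Adelic) (v : ↥(adelicUnipotent F E c 2)) => ((quasiSplit F E c 2).toAdelic (weylLongU (c : E →+* E) (rfl : (StdForm.antidiagonal 2).over E = (StdForm.antidiagonal 2).over E))) * ((v : (quasiSplit F E c 2).Adelic) * g)) g
    beta_reduce at hC
    have e := ((congrArg (starRingEnd ℂ) hA).trans hC).trans hB.symm
    rw [← e, _root_.map_sum]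
    exact Finset.sum_congr rfl fun j' _ => by rw [map_mul, hb' j' g]
  -- linear independence of the `b′_j` (and `c_G` an involution)
  have hzero : (∑ j', (conj (q i j' z) - q i j' (conj z)) • b' j') = 0 := by
    funext g'
    have h := key (cG g')
    rw [galTwist_galTwist hc hcG] at h
    rw [Finset.sum_apply, Pi.zero_apply]
    simp only [Pi.smul_apply, smul_eq_mul, sub_mul, Finset.sum_sub_distrib, h, sub_self]
  have hc0 := Fintype.linearIndependent_iff.1 hli (fun j' => conj (q i j' z) - q i j' (conj z)) hzero j
  exact (sub_eq_zero.1 hc0).symm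

/-! ## §2 Off the pole set, entrywise -/

/-- **`qc_{ij}(conj z) = conj qc_{ij}(z)` OFF `P ∪ conj P`** for the continued coordinates: §1 on the tube, `qc = q` there, then ★ `apply_conj_eq_conj_apply_of_tube_of_poleSet` per entry (ONE
closed co-discrete `P ⊆ {Re ≤ 1}`, `qc_{ij}` analytic off `P` — ★ X2_χ's clause shapes). [cite: MoeglinWaldspurger1995, IV.1.10] [cite: Langlands1976, §7] -/
theorem matrix_conj_of_real_of_poleSet (hc : c * c = 1) {cG : (quasiSplit F E c 2).Adelic →* (quasiSplit F E c 2).Adelic}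
    (hcG : ∀ g, adelicVal F E c 2 _ (cG g) = Matrix.GeneralLinearGroup.map (conjAdele F E c) (adelicVal F E c 2 _ g))
    (ν : Measure ↥(adelicUnipotent F E c 2)) [ν.IsInvInvariant] (r : ℝ)
    {ι ι' : Type*} [Fintype ι'] {b : ι → (quasiSplit F E c 2).Adelic → ℂ} {b' : ι' → (quasiSplit F E c 2).Adelic → ℂ}
    (hb : ∀ i g, conj (b i g) = b i (cG g)) (hb' : ∀ j g, conj (b' j g) = b' j (cG g)) (hli : LinearIndependent ℂ b')
    {q qc : ι → ι' → ℂ → ℂ} {P : Set ℂ}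
    (hq : ∀ i (z : ℂ), 1 < z.re → (∑ j, q i j z • b' j) = ((r : ℝ) : ℂ) • (fun g : (quasiSplit F E c 2).Adelic => (∫ v : ↥(adelicUnipotent F E c 2), flatSectionU (b i) z (((quasiSplit F E c 2).toAdelic (weylLongU (c : E →+* E) (rfl : (StdForm.antidiagonal 2).over E = (StdForm.antidiagonal 2).over E))) * ((v : (quasiSplit F E c 2).Adelic) * g)) ∂ν) * (((borelHeight g : ℝ) : ℂ) ^ (z - 1))))
    (hqcq : ∀ i j (z : ℂ), 1 < z.re → qc i j z = q i j z)
    (hPc : IsClosed P) (hPcd : ∀ z₀ : ℂ, ∀ᶠ s in 𝓝[≠] z₀, s ∉ P) (hPre : ∀ z ∈ P, z.re ≤ 1) (hqa : ∀ i j (z : ℂ), z ∉ P → AnalyticAt ℂ (qc i j) z) :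
    ∀ i j (z : ℂ), z ∉ P → conj z ∉ P → qc i j (conj z) = conj (qc i j z) := fun i j =>
  apply_conj_eq_conj_apply_of_tube_of_poleSet hPc hPcd hPre (hqa i j) fun z hz => by
    rw [hqcq i j z hz, hqcq i j (conj z) (by rwa [Complex.conj_re]), matrix_tube_conj_of_real hc hcG ν r hb hb' hli hq i j z hz]

end Generic

/-! ## §3 The `U(1,1)_{L∕L⁺}` print at a `c_G`-stable level `K′` -/

section CM

variable (L : Type) [Field L] [NumberField L] [IsCMField L]
variable [MeasurableSpace (quasiSplit (↥(maximalRealSubfield L)) L (IsCMField.complexConj L) 2).Adelic] [BorelSpace (quasiSplit (↥(maximalRealSubfield L)) L (IsCMField.complexConj L) 2).Adelic]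

/-- **G7 — `hconj` FOR THE SCATTERING MATRIX OF A SELF-DUAL UNITARY `χ` OF `U(1,1)_{L∕L⁺}` AT A `c_G`-STABLE LEVEL `K′`, ENTRYWISE** (module docstring): the Galois twist `c_G` of
★ `exists_galTwist_cm`; a level `K′` (any subgroup; representatives from `K_max ⧸ (K′ ∩ K_max)`) with the LEVEL LETTER `hK : c_G(K′) ⊆ K′` and a `K′`-type `ω` with `conj ω(k) = ω(c_G k)`; sections `b_i ∈ V(χ, K′, ω)` and a linearly independent
family `b′_j ∈ V(χʷ, K′, ω)` that are REAL ON THE REPRESENTATIVES `q.out`, `q ∈ K_max ⧸ (K′ ∩ K_max)`; and ANY continued package `(q, qc, P)` with the X2_χ clause shapes per basis vector.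
THEN `qc_{ij}(conj z) = conj qc_{ij}(z)` off `P ∪ conj P` (§2 with `hb`, `hb′` from ★ `conj_apply_eq_apply_galTwist_of_selfDual_of_reps` ∘ ★ `forall_exists_borel_mul_out_mul_of_iwasawa` ∘ ★ adelic
Iwasawa).  At `K′ = K_max`, `ι = ι′ = Unit` this is ★ p860445. [cite: MoeglinWaldspurger1995, II.1.7, IV.1.10] [cite: Langlands1976, §7] [cite: GelbartRogawski1991, §3.1] -/
theorem chi_scattering_matrix_conj_symm_level_cm_two
    {cG : (quasiSplit (↥(maximalRealSubfield L)) L (IsCMField.complexConj L) 2).Adelic →* (quasiSplit (↥(maximalRealSubfield L)) L (IsCMField.complexConj L) 2).Adelic}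
    (hcG : ∀ g, adelicVal (↥(maximalRealSubfield L)) L (IsCMField.complexConj L) 2 _ (cG g) =
      Matrix.GeneralLinearGroup.map (conjAdele (↥(maximalRealSubfield L)) L (IsCMField.complexConj L)) (adelicVal (↥(maximalRealSubfield L)) L (IsCMField.complexConj L) 2 _ g))
    (ν : Measure ↥(adelicUnipotent (↥(maximalRealSubfield L)) L (IsCMField.complexConj L) 2)) [ν.IsInvInvariant] (𝓕 : Set ↥(adelicUnipotent (↥(maximalRealSubfield L)) L (IsCMField.complexConj L) 2))
    -- the level: any subgroup `K′` (representatives come from `K_max ⧸ (K′ ∩ K_max)`), `c_G`-stable (THE level letter), with a `c_G`-compatible `K′`-type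
    (K' : Subgroup (quasiSplit (↥(maximalRealSubfield L)) L (IsCMField.complexConj L) 2).Adelic) (hK : ∀ k : ↥K', cG (k : (quasiSplit (↥(maximalRealSubfield L)) L (IsCMField.complexConj L) 2).Adelic) ∈ K')
    {ω : ↥K' → ℂ} (hω : ∀ k : ↥K', conj (ω k) = ω ⟨cG (k : (quasiSplit (↥(maximalRealSubfield L)) L (IsCMField.complexConj L) 2).Adelic), hK k⟩)
    -- the self-dual unitary character and the two families of sections, real on the representatives
    {χ : HeckeCharacter L} (hsd : reflectChar (IsCMField.complexConj L) χ = χ) (hχ : χ.IsUnitary)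
    {ι ι' : Type*} [Fintype ι'] {b : ι → (quasiSplit (↥(maximalRealSubfield L)) L (IsCMField.complexConj L) 2).Adelic → ℂ} {b' : ι' → (quasiSplit (↥(maximalRealSubfield L)) L (IsCMField.complexConj L) 2).Adelic → ℂ}
    (hbV : ∀ i, b i ∈ chiSectionSpace χ K' ω) (hb'V : ∀ j, b' j ∈ chiSectionSpace (reflectChar (IsCMField.complexConj L) χ) K' ω) (hli : LinearIndependent ℂ b')
    (hbreps : ∀ i (q : ↥((standardMaximalCompactGL 2 L).comap (adelicVal (↥(maximalRealSubfield L)) L (IsCMField.complexConj L) 2 ((StdForm.antidiagonal 2).over L)) : Subgroup (quasiSplit (↥(maximalRealSubfield L)) L (IsCMField.complexConj L) 2).Adelic) ⧸ K'.subgroupOf ((standardMaximalCompactGL 2 L).comap (adelicVal (↥(maximalRealSubfield L)) L (IsCMField.complexConj L) 2 ((StdForm.antidiagonal 2).over L)) : Subgroup (quasiSplit (↥(maximalRealSubfield L)) L (IsCMField.complexConj L) 2).Adelic)), conj (b i (((Quotient.out q : ↥((standardMaximalCompactGL 2 L).comap (adelicVal (↥(maximalRealSubfield L)) L (IsCMField.complexConj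 L) 2 ((StdForm.antidiagonal 2).over L)) : Subgroup (quasiSplit (↥(maximalRealSubfield L)) L (IsCMField.complexConj L) 2).Adelic))) : (quasiSplit (↥(maximalRealSubfield L)) L (IsCMField.complexConj L) 2).Adelic)) = b i (cG (((Quotient.out q : ↥((standardMaximalCompactGL 2 L).comap (adelicVal (↥(maximalRealSubfield L)) L (IsCMField.complexConj L) 2 ((StdForm.antidiagonal 2).over L)) : Subgroup (quasiSplit (↥(maximalRealSubfield L)) L (IsCMField.complexConj L) 2).Adelic))) : (quasiSplit (↥(maximalRealSubfield L)) L (IsCMField.complexConj L) 2).Adelic)))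
    (hb'reps : ∀ j (q : ↥((standardMaximalCompactGL 2 L).comap (adelicVal (↥(maximalRealSubfield L)) L (IsCMField.complexConj L) 2 ((StdForm.antidiagonal 2).over L)) : Subgroup (quasiSplit (↥(maximalRealSubfield L)) L (IsCMField.complexConj L) 2).Adelic) ⧸ K'.subgroupOf ((standardMaximalCompactGL 2 L).comap (adelicVal (↥(maximalRealSubfield L)) L (IsCMField.complexConj L) 2 ((StdForm.antidiagonal 2).over L)) : Subgroup (quasiSplit (↥(maximalRealSubfield L)) L (IsCMField.complexConj L) 2).Adelic)), conj (b' j (((Quotient.out q : ↥((standardMaximalCompactGL 2 L).comap (adelicVal (↥(maximalRealSubfield L)) L (IsCMField.complexConj L) 2 ((StdForm.antidiagonal 2).over L)) : Subgroup (quasiSplit (↥(maximalRealSubfield L)) L (IsCMField.complexConj L) 2).Adelic))) : (quasiSplit (↥(maximalRealSubfield L)) L (IsCMField.complexConj L) 2).Adelic)) = b' j (cG (((Quotient.out q : ↥((standardMaximalCompactGL 2 L).comap (adelicVal (↥(maximalRealSubfield L)) L (IsCMField.complexConj L) 2 ((StdForm.antidiagonal 2).over L)) : Subgroup (quasiSplit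 (↥(maximalRealSubfield L)) L (IsCMField.complexConj L) 2).Adelic))) : (quasiSplit (↥(maximalRealSubfield L)) L (IsCMField.complexConj L) 2).Adelic)))
    -- the continued package per basis vector (★ X2_χ ∕ (α) clause shapes)
    {q qc : ι → ι' → ℂ → ℂ} {P : Set ℂ}
    (hqφ : ∀ i (z : ℂ), 1 < z.re → (∑ j, q i j z • b' j) = ((((ν 𝓕).toReal⁻¹ : ℝ)) : ℂ) • (fun g : (quasiSplit (↥(maximalRealSubfield L)) L (IsCMField.complexConj L) 2).Adelic => (∫ v : ↥(adelicUnipotent (↥(maximalRealSubfield L)) L (IsCMField.complexConj L) 2), flatSectionU (b i) z ((quasiSplit (↥(maximalRealSubfield L)) L (IsCMField.complexConj L) 2).toAdelic (weylLongU ((IsCMField.complexConj L : L ≃ₐ[↥(maximalRealSubfield L)] L) : L →+* L) (rfl : (StdForm.antidiagonal 2).over L = (StdForm.antidiagonal 2).over L)) * ((v : (quasiSplit (↥(maximalRealSubfield L)) L (IsCMField.complexConj L) 2).Adelic) * g)) ∂ν) * (((borelHeight g : ℝ) : ℂ) ^ (z - 1))))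
    (hqcq : ∀ i j (z : ℂ), 1 < z.re → qc i j z = q i j z)
    (hPc : IsClosed P) (hPcd : ∀ z₀ : ℂ, ∀ᶠ s in 𝓝[≠] z₀, s ∉ P) (hPre : ∀ z ∈ P, z.re ≤ 1) (hqa : ∀ i j (z : ℂ), z ∉ P → AnalyticAt ℂ (qc i j) z) :
    ∀ i j (z : ℂ), z ∉ P → conj z ∉ P → qc i j (conj z) = conj (qc i j z) := by
  have hc : IsCMField.complexConj L * IsCMField.complexConj L = 1 := AlgEquiv.ext fun x => IsCMField.complexConj_apply_apply L x
  -- double-coset representatives from the adelic Iwasawa decomposition at the CM pair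
  have hIw := forall_exists_borel_mul_out_mul_of_iwasawa K' (exists_mem_borelAdelic_mul_mem_standardMaximalCompactGL_cm L (N := 2))
  -- realness of the sections everywhere ((H3) at level `K′`)
  have hb : ∀ i g, conj (b i g) = b i (cG g) := fun i =>
    conj_apply_eq_apply_galTwist_of_selfDual_of_reps hc hcG K' hK hω _ hIw hsd hχ (hbV i) (hbreps i)
  have hsd' : reflectChar (IsCMField.complexConj L) (reflectChar (IsCMField.complexConj L) χ) = reflectChar (IsCMField.complexConj L) χ := by rw [hsd, hsd]
  have hχ' : (reflectChar (IsCMField.complexConj L) χ).IsUnitary := by rw [hsd]; exact hχ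
  have hb' : ∀ j g, conj (b' j g) = b' j (cG g) := fun j =>
    conj_apply_eq_apply_galTwist_of_selfDual_of_reps hc hcG K' hK hω _ hIw hsd' hχ' (hb'V j) (hb'reps j)
  exact matrix_conj_of_real_of_poleSet hc hcG ν ((ν 𝓕).toReal⁻¹) hb hb' hli hqφ hqcq hPc hPcd hPre hqa

end CM

end Summit.HodgeConjecture.HodgeConjecture.Cruxes.H413.K2E1ChiScatteringConjSymmetryLevelCMTwo

end
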